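import Summits.CriticalPhenomena.PercolationContinuityZ3.Theorems.Transplant.AutChartOrbitsCriticalContinuity
import HarnessLib

/-!
# PATTERN GRAPHS over a group with a character: vertices `Γ × Fin k`, bonds by right letters between sheets — `θ_v(p_c) = 0 ∧ p_c < 1` UNCONDITIONALLY whenever
# every sheet carries the four unit axis letters and every letter has chart sup-norm `≤ 1` (a front-end of the orbit theorem; customers become one-liners)

builds on p205010 (kernel theorem, internal audit signed; external expert review pending): the theorem runs through `AutChart.criticalContinuity_of_autSubgroup_finite_orbits`
/ `conj4_…` («AutChartOrbitsCriticalContinuity» p493117 / p495338), which build on p205010.  Lane `prim-bschramm`, seat `prim-bschramm-p3` gen 28 (design owner; P3-NILPOTENT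
§20.2/§20.7: the common shape of the (N3-a) customers (c1′), (c3), (c4), X′ and of the pending (c1), (c2)).  Helper file (`--supports stmt-CriticalPhenomena-4575 --as helper`).

THE OBJECT.  `Γ` a group, `c : Γ → ℤ²` a homomorphism (written multiplicatively into `Multiplicative (Site 2)`), `k` sheets, and a PATTERN `P : Fin k → Finset (Γ × Fin k)`:
the pattern graph `PatternGraph.graph P` on `Γ × Fin k` has the bonds `(g, j) ∼ (g s, j′)` for `(s, j′) ∈ P j` (symmetrised; loops discarded).  `Γ` acts by LEFT
multiplication (`leftIso`), by automorphisms, with the `k` sheets as orbits and transversal `{(1, j)}`; the chart `(g, j) ↦ c g` is translated by the action and vanishes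
on the transversal.  Examples: Cayley graphs of `Γ ⋊ F` / `Γ × F` read on the cosets of `Γ` (X′ = ℤ² □ C₄, the skew bilayers (c3)/(c1), (c2)), decorated multilayers
((c4), (c1′) «HeisenbergDecoratedBilayer»), every `Γ`-periodic graph whose vertex orbits are identified with `Γ`.
THE THEOREM (`PatternGraph.criticalContinuity` / `conj4`): if every letter has `‖c s‖_∞ ≤ 1` (`hrange`), every sheet `j` has in-sheet letters `(s, j) ∈ P j` with
`c s = ± eᵢ` for both axes and signs (`hstep`), and the graph is connected (`hc`; helper `connected_of_links`: sheet-`j₀` letters generating `Γ` + a letter from every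
sheet into sheet `j₀`), then `p_c < 1` and `θ_v(p_c) = 0` at every vertex — no cylinder / growth / uniqueness / stabiliser hypothesis (the orbit theorem carries them;
`Γ` need not be finitely generated, abelian, nilpotent or of subexponential growth).
[cite: BenjaminiSchramm1996, Conj. 4; §2 (quasi-transitive graphs)] [cite: KozmaNitzan2024, §4 p. 16 (Lemma 8)]
-/

noncomputable section

namespace Summit.CriticalPhenomena.PercolationContinuityZ3.Theorems.Transplant

open MeasureTheory Literature.Probability.Percolation Literature.Probability.LatticeModels SimpleGraph
open scoped Classical

namespace PatternGraph

variable {Γ : Type} [Group Γ] {k : ℕ} (P : Fin k → Finset (Γ × Fin k))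

/-! ## §1 The pattern graph, its neighbours, local finiteness -/

/-- **The pattern graph**: `(g, j) ∼ (g s, j′)` for `(s, j′) ∈ P j` (symmetrised). [cite: BenjaminiSchramm1996, §2 (quasi-transitive graphs)] -/
def graph : SimpleGraph (Γ × Fin k) :=
  SimpleGraph.fromRel fun a b => ∃ p ∈ P a.2, b = (a.1 * p.1, p.2)

/-- Adjacency unfolded. [folklore] -/
theorem adj_iff (a b : Γ × Fin k) :
    (graph P).Adj a b ↔ a ≠ b ∧ ((∃ p ∈ P a.2, b = (a.1 * p.1, p.2)) ∨ (∃ p ∈ P b.2, a = (b.1 * p.1, p.2))) :=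
  SimpleGraph.fromRel_adj _ _ _

/-- A pattern letter gives a bond (unless it is a loop). [folklore] -/
theorem adj_of_mem (a : Γ × Fin k) {p : Γ × Fin k} (hp : p ∈ P a.2) (hne : a ≠ (a.1 * p.1, p.2)) : (graph P).Adj a (a.1 * p.1, p.2) :=
  (adj_iff P _ _).2 ⟨hne, Or.inl ⟨p, hp, rfl⟩⟩

/-- The candidate neighbours of `a`: the pattern letters of its sheet, and the reversed letters of every sheet pointing into its sheet. [folklore] -/
def nbrs (a : Γ × Fin k) : Finset (Γ × Fin k) :=
  (P a.2).image (fun p => (a.1 * p.1, p.2)) ∪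
    Finset.univ.biUnion fun j₀ => ((P j₀).filter fun p => p.2 = a.2).image fun p => (a.1 * p.1⁻¹, j₀)

/-- Every neighbour is a candidate. [folklore] -/
theorem mem_nbrs_of_adj {a b : Γ × Fin k} (h : (graph P).Adj a b) : b ∈ nbrs P a := by
  obtain ⟨-, h | h⟩ := (adj_iff P _ _).1 h
  · obtain ⟨p, hp, rfl⟩ := h
    exact Finset.mem_union_left _ (Finset.mem_image.2 ⟨p, hp, rfl⟩)
  · obtain ⟨p, hp, hab⟩ := h
    refine Finset.mem_union_right _ (Finset.mem_biUnion.2 ⟨b.2, Finset.mem_univ _, Finset.mem_image.2 ⟨p, Finset.mem_filter.2 ⟨hp, ?_⟩, ?_⟩⟩)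
    · rw [hab]
    · rw [hab]; simp

/-- The neighbour set lies in the candidate set. [folklore] -/
theorem neighborSet_subset (a : Γ × Fin k) : (graph P).neighborSet a ⊆ ↑(nbrs P a) := fun _ hb => mem_nbrs_of_adj P hb

/-- The pattern graph is locally finite. [folklore] -/
instance graph_locallyFinite : (graph P).LocallyFinite := fun a => ((Finset.finite_toSet _).subset (neighborSet_subset P a)).fintype

/-! ## §2 Frames: left multiplication, a subgroup of `Aut` with the sheets as orbits -/

/-- Left multiplication preserves adjacency. [folklore] -/
theorem adj_leftMul (g : Γ) {a b : Γ × Fin k} (h : (graph P).Adj a b) : (graph P).Adj (g * a.1, a.2) (g * b.1, b.2) := by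
  obtain ⟨hne, h⟩ := (adj_iff P _ _).1 h
  refine (adj_iff P _ _).2 ⟨fun e => ?_, ?_⟩
  · have e1 := congrArg Prod.fst e
    have e2 := congrArg Prod.snd e
    dsimp only at e1 e2
    exact hne (Prod.ext (mul_left_cancel e1) e2)
  rcases h with ⟨p, hp, hb⟩ | ⟨p, hp, ha⟩
  · exact Or.inl ⟨p, hp, by rw [hb]; simp [mul_assoc]⟩
  · exact Or.inr ⟨p, hp, by rw [ha]; simp [mul_assoc]⟩

/-- **Left translation** `(h, j) ↦ (g h, j)` is an automorphism of the pattern graph. [cite: BenjaminiSchramm1996, §2] -/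
def leftIso (g : Γ) : graph P ≃g graph P where
  toEquiv := Equiv.prodCongr (Equiv.mulLeft g) (Equiv.refl _)
  map_rel_iff' := by
    intro a b
    show (graph P).Adj (g * a.1, a.2) (g * b.1, b.2) ↔ (graph P).Adj a b
    refine ⟨fun h => ?_, adj_leftMul P g⟩
    have := adj_leftMul P g⁻¹ h
    simpa using this

/-- `leftIso g (h, j) = (g h, j)`. [folklore] -/
@[simp] theorem leftIso_apply (g : Γ) (a : Γ × Fin k) : leftIso P g a = (g * a.1, a.2) := rfl

/-- The left translations as a homomorphism `Γ → Aut`. [folklore] -/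
def leftHom : Γ →* (graph P ≃g graph P) where
  toFun := leftIso P
  map_one' := RelIso.ext fun a => by simp
  map_mul' g g' := RelIso.ext fun a => by simp [mul_assoc]

/-- **The frames**: the subgroup `A ≤ Aut` of left translations. [cite: BenjaminiSchramm1996, §2] -/
def transl : Subgroup (graph P ≃g graph P) := (leftHom P).range

/-- Membership in `A`. [folklore] -/
theorem mem_transl {α : graph P ≃g graph P} : α ∈ transl P ↔ ∃ g : Γ, leftIso P g = α := by
  rw [transl, MonoidHom.mem_range]; rfl

/-- The transversal: the identity on each sheet. [folklore] -/
def reps : Finset (Γ × Fin k) := Finset.univ.image fun j => ((1 : Γ), j)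

/-- Membership in the transversal. [folklore] -/
theorem mem_reps {r : Γ × Fin k} : r ∈ reps (Γ := Γ) (k := k) ↔ r.1 = 1 := by
  constructor
  · intro hr
    obtain ⟨j, -, rfl⟩ := Finset.mem_image.1 hr
    rfl
  · intro hr
    exact Finset.mem_image.2 ⟨r.2, Finset.mem_univ _, Prod.ext hr.symm rfl⟩

/-- **`reps` meets every `A`-orbit at most once.** [folklore] -/
theorem reps_trans : ∀ r ∈ reps (Γ := Γ) (k := k), ∀ r' ∈ reps (Γ := Γ) (k := k), ∀ α ∈ transl P, α r = r' → r = r' := by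
  intro r hr r' hr' α hα h
  obtain ⟨g, rfl⟩ := (mem_transl P).1 hα
  rw [leftIso_apply] at h
  have h2 := congrArg Prod.snd h
  dsimp only at h2
  exact Prod.ext (by rw [(mem_reps).1 hr, (mem_reps).1 hr']) h2

/-- **`reps` meets every `A`-orbit**: `(g, j) = leftIso g (1, j)`. [folklore] -/
theorem reps_cover : ∀ w : Γ × Fin k, ∃ α ∈ transl P, ∃ r ∈ reps (Γ := Γ) (k := k), α r = w := by
  rintro ⟨g, j⟩
  exact ⟨leftIso P g, (mem_transl P).2 ⟨g, rfl⟩, ((1 : Γ), j), (mem_reps).2 rfl, by simp⟩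

/-! ## §3 Connectedness helpers -/

/-- **In-sheet reachability from generation**: if the in-sheet letters of sheet `j` contain a set `S` generating `Γ`, every vertex of sheet `j` is joined to `(1, j)`.
[folklore] -/
theorem reachable_sheet {S : Set Γ} (hS : Subgroup.closure S = ⊤) (j : Fin k) (hSP : ∀ s ∈ S, (s, j) ∈ P j) (g : Γ) :
    (graph P).Reachable ((1 : Γ), j) (g, j) := by
  have hmem : g ∈ Subgroup.closure S := by rw [hS]; exact Subgroup.mem_top g
  induction hmem using Subgroup.closure_induction with
  | mem x hx =>
    by_cases h1 : x = 1
    · subst h1; exact Reachable.refl _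
    · have hadj := adj_of_mem P (((1 : Γ), j)) (hSP x hx) (fun e => h1 (by simpa using (congrArg Prod.fst e).symm))
      simpa using hadj.reachable
  | one => exact Reachable.refl _
  | mul x y _ _ hx hy =>
    have hy' : (graph P).Reachable ((x * 1, j) : Γ × Fin k) (x * y, j) := hy.map (leftIso P x).toHom
    rw [mul_one] at hy'
    exact hx.trans hy'
  | inv x _ hx =>
    have hx' : (graph P).Reachable ((x⁻¹ * 1, j) : Γ × Fin k) (x⁻¹ * x, j) := hx.map (leftIso P x⁻¹).toHom
    rw [mul_one, inv_mul_cancel] at hx'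
    exact hx'.symm

/-- **Connectedness from links**: if every vertex of sheet `j₀` is joined to `(1, j₀)` and every sheet reaches sheet `j₀` from its identity vertex, the pattern graph is
connected. [folklore] -/
theorem connected_of_reach (j₀ : Fin k) (hsheet : ∀ g : Γ, (graph P).Reachable ((1 : Γ), j₀) (g, j₀))
    (hlink : ∀ j : Fin k, ∃ g : Γ, (graph P).Reachable ((1 : Γ), j) (g, j₀)) : (graph P).Connected := by
  haveI : Nonempty (Γ × Fin k) := ⟨((1 : Γ), j₀)⟩
  refine Connected.mk fun a b => ?_
  suffices H : ∀ w : Γ × Fin k, (graph P).Reachable ((1 : Γ), j₀) w from (H a).symm.trans (H b)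
  rintro ⟨g, j⟩
  obtain ⟨g', hg'⟩ := hlink j
  -- `(g, j) = g • (1, j)` is joined to `g • (g', j₀) = (g g', j₀)`, which is joined to `(1, j₀)`
  have h1 : (graph P).Reachable ((g * 1, j) : Γ × Fin k) (g * g', j₀) := hg'.map (leftIso P g).toHom
  rw [mul_one] at h1
  exact (hsheet (g * g')).trans h1.symm

/-- **Connectedness from direct links**: sheet `j₀` generated and a letter from every sheet into sheet `j₀`. [folklore] -/
theorem connected_of_links (j₀ : Fin k) (hsheet : ∀ g : Γ, (graph P).Reachable ((1 : Γ), j₀) (g, j₀)) (hlink : ∀ j : Fin k, ∃ s : Γ, (s, j₀) ∈ P j) :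
    (graph P).Connected := by
  refine connected_of_reach P j₀ hsheet fun j => ?_
  obtain ⟨s, hs⟩ := hlink j
  by_cases hj : j = j₀
  · subst hj; exact ⟨1, Reachable.refl _⟩
  · refine ⟨1 * s, (adj_of_mem P ((1 : Γ), j) hs (fun e => hj ?_)).reachable⟩
    have e2 := congrArg Prod.snd e
    dsimp only at e2
    exact e2

/-! ## §4 The chart of a character and the unconditional theorem -/

variable (c : Γ →* Multiplicative (Site 2))

/-- The chart is translated by `A`: `c (α w).1 = c w.1 + (c (α t).1 − c t.1)` with `t = (1, j)`. [folklore] -/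
theorem chart_transl (t : Γ × Fin k) (ht : t.1 = 1) : ∀ α ∈ transl P, ∀ w : Γ × Fin k,
    Multiplicative.toAdd (c (α w).1) = Multiplicative.toAdd (c w.1) + (Multiplicative.toAdd (c (α t).1) - Multiplicative.toAdd (c t.1)) := by
  intro α hα w
  obtain ⟨g, rfl⟩ := (mem_transl P).1 hα
  simp only [leftIso_apply, map_mul, toAdd_mul, ht, mul_one, map_one, toAdd_one, sub_zero]
  rw [add_comm]

/-- The chart is constant (`= 0`) on the transversal. [folklore] -/
theorem chart_reps : ∀ r ∈ reps (Γ := Γ) (k := k), ∀ r' ∈ reps (Γ := Γ) (k := k), Multiplicative.toAdd (c r.1) = Multiplicative.toAdd (c r'.1) :=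
  fun r hr r' hr' => by rw [(mem_reps).1 hr, (mem_reps).1 hr']

/-- **Unit range at the representatives** from `‖c s‖_∞ ≤ 1` on the pattern letters (reversed letters carry `−c s`). [folklore] -/
theorem chart_lip (hrange : ∀ j : Fin k, ∀ p ∈ P j, ∀ i : Fin 2, |Multiplicative.toAdd (c p.1) i| ≤ 1) :
    ∀ r ∈ reps (Γ := Γ) (k := k), ∀ w : Γ × Fin k, (graph P).Adj r w →
      ∀ i : Fin 2, |Multiplicative.toAdd (c w.1) i - Multiplicative.toAdd (c r.1) i| ≤ ((1 : ℕ) : ℤ) := by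
  intro r hr w hw i
  have hb := mem_nbrs_of_adj P hw
  rw [(mem_reps).1 hr, map_one, toAdd_one, Pi.zero_apply, sub_zero, Nat.cast_one]
  rcases Finset.mem_union.1 hb with hb | hb
  · obtain ⟨p, hp, rfl⟩ := Finset.mem_image.1 hb
    simpa [(mem_reps).1 hr] using hrange r.2 p hp i
  · obtain ⟨j₀, -, hb⟩ := Finset.mem_biUnion.1 hb
    obtain ⟨p, hp, rfl⟩ := Finset.mem_image.1 hb
    have h := hrange j₀ p (Finset.mem_filter.1 hp).1 i
    simpa [(mem_reps).1 hr, abs_neg] using h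

/-- **Exact unit steps along single bonds at the representatives** from the in-sheet axis letters. [folklore] -/
theorem chart_step (hstep : ∀ (j : Fin k) (i : Fin 2) (σ : ℤˣ), ∃ p ∈ P j, p.2 = j ∧ Multiplicative.toAdd (c p.1) = Pi.single i (σ : ℤ)) :
    ∀ r ∈ reps (Γ := Γ) (k := k), ∀ (i : Fin 2) (σ : ℤˣ), ∃ w : Γ × Fin k, (graph P).Adj r w ∧
      Multiplicative.toAdd (c w.1) = Multiplicative.toAdd (c r.1) + Pi.single i (((1 : ℕ) : ℤ) * σ) := by
  intro r hr i σ
  obtain ⟨p, hp, hp2, hcp⟩ := hstep r.2 i σ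
  have hs1 : p.1 ≠ 1 := fun e => by
    rw [e, map_one, toAdd_one] at hcp
    have := congrFun hcp i
    simp at this
    exact σ.ne_zero this.symm
  refine ⟨(r.1 * p.1, p.2), adj_of_mem P r hp (fun e => hs1 ?_), ?_⟩
  · have e1 := congrArg Prod.fst e
    dsimp only at e1
    exact (mul_eq_left.1 e1.symm)
  · rw [(mem_reps).1 hr, one_mul, map_one, toAdd_one, zero_add, hcp, Nat.cast_one, one_mul]

/-- **THEOREM (unconditional) — PATTERN GRAPHS.**  `Γ` a group with a homomorphism `c : Γ → ℤ²`; a pattern `P` on `k` sheets whose letters all have `‖c s‖_∞ ≤ 1`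
(`hrange`) and which carries, in every sheet, in-sheet letters with `c s = ± eᵢ` for both axes and signs (`hstep`); the pattern graph connected (`hc`).  Then
**`θ_v(p_c) = 0` at every vertex** — by the orbit theorem on the left translations (`k` orbits, transversal `{(1, j)}`, chart `c`, `N = 1`).
builds on p205010 (kernel theorem, internal audit signed; external expert review pending). [cite: BenjaminiSchramm1996, Conj. 4; §2 (quasi-transitive graphs)]
[cite: KozmaNitzan2024, §4 p. 16 (Lemma 8)] -/
theorem criticalContinuity [NeZero k] (hc : (graph P).Connected) (hrange : ∀ j : Fin k, ∀ p ∈ P j, ∀ i : Fin 2, |Multiplicative.toAdd (c p.1) i| ≤ 1)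
    (hstep : ∀ (j : Fin k) (i : Fin 2) (σ : ℤˣ), ∃ p ∈ P j, p.2 = j ∧ Multiplicative.toAdd (c p.1) = Pi.single i (σ : ℤ)) (v : Γ × Fin k) :
    theta (graph P) v (criticalProbIOf (graph P) v) = 0 :=
  AutChart.criticalContinuity_of_autSubgroup_finite_orbits hc (transl P) reps (reps_trans P) (reps_cover P) (fun a => Multiplicative.toAdd (c a.1))
    (t := ((1 : Γ), (0 : Fin k))) (chart_transl P c _ rfl) (chart_reps c) 1 le_rfl (chart_lip P c hrange) (chart_step P c hstep) v

/-- **Conj. 4 in its own shape for pattern graphs**: `p_c < 1 ∧ θ_v(p_c) = 0`. builds on p205010 (kernel theorem, internal audit signed; external expert review pending).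
[cite: BenjaminiSchramm1996, Conj. 4; §2 Conj. 1] -/
theorem conj4 [NeZero k] (hc : (graph P).Connected) (hrange : ∀ j : Fin k, ∀ p ∈ P j, ∀ i : Fin 2, |Multiplicative.toAdd (c p.1) i| ≤ 1)
    (hstep : ∀ (j : Fin k) (i : Fin 2) (σ : ℤˣ), ∃ p ∈ P j, p.2 = j ∧ Multiplicative.toAdd (c p.1) = Pi.single i (σ : ℤ)) (v : Γ × Fin k) :
    criticalProb (graph P) v < 1 ∧ theta (graph P) v (criticalProbIOf (graph P) v) = 0 :=
  AutChart.conj4_of_autSubgroup_finite_orbits hc (transl P) reps (reps_trans P) (reps_cover P) (fun a => Multiplicative.toAdd (c a.1))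
    (t := ((1 : Γ), (0 : Fin k))) (chart_transl P c _ rfl) (chart_reps c) 1 le_rfl (chart_lip P c hrange) (chart_step P c hstep) v

/-- **… and the same-`p` drop at every vertex.** [cite: BenjaminiSchramm1996, Conj. 4] -/
theorem drop [NeZero k] (hc : (graph P).Connected) (hrange : ∀ j : Fin k, ∀ p ∈ P j, ∀ i : Fin 2, |Multiplicative.toAdd (c p.1) i| ≤ 1)
    (hstep : ∀ (j : Fin k) (i : Fin 2) (σ : ℤˣ), ∃ p ∈ P j, p.2 = j ∧ Multiplicative.toAdd (c p.1) = Pi.single i (σ : ℤ)) (v : Γ × Fin k)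
    (p : unitInterval) (hθ : 0 < theta (graph P) v p) : ∃ q : unitInterval, (q : ℝ) < p ∧ 0 < theta (graph P) v q := by
  haveI : Countable (Γ × Fin k) := Literature.Barriers.CriticalPhenomena.countable_of_connected_of_locallyFinite (graph P) hc v
  exact drop_at_of_critical (graph P) v (P := fun _ => True) (fun _ => criticalContinuity P c hc hrange hstep v) p trivial hθ

end PatternGraph

end Summit.CriticalPhenomena.PercolationContinuityZ3.Theorems.Transplant

end
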